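import Literature.Analysis.UnboundedOperators.SelfAdjointResolvent
import Literature.Analysis.UnboundedOperators.SymmetricPMap
import Mathlib.Analysis.Normed.Operator.Compact.Basic
import Mathlib.Topology.Algebra.Module.FiniteDimension
import Mathlib.Analysis.Complex.Basic
import HarnessLib

/-!
# Compact resolvent from a compact right inverse of the maximal operator

RH-FREE library file (abstract operator theory).  The standard reduction used to prove that a
self-adjoint realisation of a differential expression has COMPACT RESOLVENT without touching its
boundary conditions:

Let `Wmax : H →ₗ.[ℂ] H` be any partially defined operator (think: the maximal operator `W_min^*` of a
symmetric differential expression), `W ≤ Wmax` a SELF-ADJOINT restriction (a self-adjoint realisation),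
`z` non-real, and suppose

* `R₀ : H →L[ℂ] H` is a COMPACT (e.g. Hilbert–Schmidt Green's kernel) RIGHT INVERSE of `Wmax − z`:
  `R₀ f ∈ dom Wmax` and `Wmax (R₀ f) − z R₀ f = f` for every `f`, and
* the solution space `ker (Wmax − z) = Wmax.eigenspace z` is FINITE-DIMENSIONAL (finite deficiency).

Then the resolvent `(W − z)⁻¹ = resolvent hW hz` (tree: `SelfAdjointResolvent.lean`) is compact:
`(W − z)⁻¹ f − R₀ f` solves the homogeneous equation, so `(W − z)⁻¹ − R₀` is a bounded operator with
values in the finite-dimensional `Wmax.eigenspace z`, hence of finite rank, hence compact, and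
`(W − z)⁻¹ = ((W − z)⁻¹ − R₀) + R₀`.

This is the abstract half of "all solutions are `L²` at every end point (limit-circle / quasi-regular
case) ⟹ every self-adjoint realisation has purely discrete spectrum" for Sturm–Liouville
expressions; the tree's `CompactResolventEigenbasis`-type statements then turn compactness of the
resolvent into an orthonormal eigenbasis.

## Main declarations (namespace `Literature.Analysis.UnboundedOperators`)

* `isCompactOperator_of_forall_mem_finiteDimensional` — a bounded operator with values in a
  finite-dimensional subspace is compact;
* `resolvent_sub_mem_eigenspace` — `(W − z)⁻¹ f − R₀ f ∈ Wmax.eigenspace z`;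
* `isCompactOperator_resolvent_of_rightInverse` — the reduction above;
* `isCompactOperator_resolvent_of_rightInverse'` — the same with the right-inverse identity stated on
  the domain subtype (`∀ f (h : R₀ f ∈ dom Wmax), …`), convenient when membership is proved separately.

No definitions, no named facts.

## References
* M. Reed, B. Simon, *Methods of Modern Mathematical Physics IV* (1978), §XIII.14 (compact
  resolvent), Thm. XIII.64. [ReedSimonIV1978]
* M. Reed, B. Simon, *Methods of Modern Mathematical Physics I* (1980), Thm. VI.12 (finite rank
  operators are compact), §VIII.1–2. [ReedSimonI1980]
-/

noncomputable section

open _root_.LinearPMap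
open scoped InnerProductSpace

namespace Literature.Analysis.UnboundedOperators

variable {H : Type*} [NormedAddCommGroup H] [InnerProductSpace ℂ H] [CompleteSpace H]

omit [CompleteSpace H] in
/-- **A bounded operator with values in a finite-dimensional subspace is compact** (finite-rank
operators are compact, Reed–Simon I Thm. VI.12: here in the form "range contained in a
finite-dimensional `E`", proved by factoring through `E`, a locally compact space).
[cite: ReedSimonI1980, Thm. VI.12] -/
theorem isCompactOperator_of_forall_mem_finiteDimensional {T : H →L[ℂ] H} {E : Submodule ℂ H}
    (hE : FiniteDimensional ℂ E) (h : ∀ x, T x ∈ E) : IsCompactOperator T := by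
  haveI : ProperSpace E := FiniteDimensional.proper_rclike ℂ E
  have hT : (T : H → H) = (E.subtypeL : E → H) ∘ (T.codRestrict E h) := by
    ext x; rfl
  rw [hT]
  exact (isCompactOperator_of_locallyCompactSpace_dom (T.codRestrict E h)).continuous_comp
    E.subtypeL.continuous

variable {Wmax W : H →ₗ.[ℂ] H}

omit [CompleteSpace H] in
/-- If `W ≤ Wmax` then `Wmax` extends `W`: `Wmax x = W x` on `dom W`. [folklore] -/
private theorem apply_eq_of_le (hle : W ≤ Wmax) (x : H) (hx : x ∈ W.domain) :
    (Wmax ⟨x, hle.1 hx⟩ : H) = W ⟨x, hx⟩ :=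
  (hle.2 (rfl : ((⟨x, hx⟩ : W.domain) : H) = ((⟨x, hle.1 hx⟩ : Wmax.domain) : H))).symm

/-- For a self-adjoint `W ≤ Wmax` and a right inverse `R₀` of `Wmax − z`, the difference
`(W − z)⁻¹ f − R₀ f` lies in the solution space `ker (Wmax − z) = Wmax.eigenspace z`.
[cite: ReedSimonIV1978, §XIII.14 (proof pattern of Thm. XIII.64)] -/
theorem resolvent_sub_mem_eigenspace (hle : W ≤ Wmax) (hW : IsSelfAdjoint W) {z : ℂ}
    (hz : z.im ≠ 0) (R₀ : H →L[ℂ] H)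
    (hinv : ∀ f, ∃ h : R₀ f ∈ Wmax.domain, (Wmax ⟨R₀ f, h⟩ : H) - z • R₀ f = f) (f : H) :
    resolvent hW hz f - R₀ f ∈ Wmax.eigenspace z := by
  rw [LinearPMap.mem_eigenspace_iff]
  have hmem : resolvent hW hz f ∈ W.domain := resolvent_mem_domain hW hz f
  have hmem' : resolvent hW hz f ∈ Wmax.domain := hle.1 hmem
  obtain ⟨h0, h0eq⟩ := hinv f
  refine ⟨Wmax.domain.sub_mem hmem' h0, ?_⟩
  have h1 : (Wmax ⟨resolvent hW hz f, hmem'⟩ : H) = f + z • resolvent hW hz f := by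
    rw [apply_eq_of_le hle _ hmem, map_resolvent hW hz f]
  have h2 : (Wmax ⟨R₀ f, h0⟩ : H) = f + z • R₀ f := eq_add_of_sub_eq h0eq
  have hsub : (⟨resolvent hW hz f - R₀ f, Wmax.domain.sub_mem hmem' h0⟩ : Wmax.domain) =
      ⟨resolvent hW hz f, hmem'⟩ - ⟨R₀ f, h0⟩ := rfl
  rw [hsub, LinearPMap.map_sub, h1, h2, smul_sub]
  abel

/-- **Compact right inverse of `Wmax − z` + finite deficiency ⟹ compact resolvent.**  Let
`W ≤ Wmax` be self-adjoint, `Im z ≠ 0`, `R₀` a compact operator with `R₀ f ∈ dom Wmax` and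
`Wmax (R₀ f) − z R₀ f = f` for all `f`, and `Wmax.eigenspace z` finite-dimensional.  Then the
resolvent `(W − z)⁻¹` is compact: it differs from `R₀` by an operator of finite rank.
[cite: ReedSimonIV1978, §XIII.14 Thm. XIII.64 (compact resolvent); ReedSimonI1980, Thm. VI.12] -/
theorem isCompactOperator_resolvent_of_rightInverse (hle : W ≤ Wmax) (hW : IsSelfAdjoint W)
    {z : ℂ} (hz : z.im ≠ 0) {R₀ : H →L[ℂ] H} (hR₀ : IsCompactOperator R₀)
    (hinv : ∀ f, ∃ h : R₀ f ∈ Wmax.domain, (Wmax ⟨R₀ f, h⟩ : H) - z • R₀ f = f)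
    (hfin : FiniteDimensional ℂ (Wmax.eigenspace z)) :
    IsCompactOperator (resolvent hW hz) := by
  have hD : IsCompactOperator (resolvent hW hz - R₀) :=
    isCompactOperator_of_forall_mem_finiteDimensional hfin fun f => by
      simpa using resolvent_sub_mem_eigenspace hle hW hz R₀ hinv f
  have hsum := hD.add hR₀
  have hfun : (⇑(resolvent hW hz - R₀) + ⇑R₀ : H → H) = ⇑(resolvent hW hz) := by
    ext f; simp
  rwa [hfun] at hsum

/-- The same reduction with the right-inverse identity split into a membership clause and an
equation on the domain subtype. [cite: ReedSimonIV1978, §XIII.14 Thm. XIII.64 (compact resolvent)] -/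
theorem isCompactOperator_resolvent_of_rightInverse' (hle : W ≤ Wmax) (hW : IsSelfAdjoint W)
    {z : ℂ} (hz : z.im ≠ 0) {R₀ : H →L[ℂ] H} (hR₀ : IsCompactOperator R₀)
    (hmem : ∀ f, R₀ f ∈ Wmax.domain)
    (heq : ∀ f, (Wmax ⟨R₀ f, hmem f⟩ : H) = f + z • R₀ f)
    (hfin : FiniteDimensional ℂ (Wmax.eigenspace z)) :
    IsCompactOperator (resolvent hW hz) :=
  isCompactOperator_resolvent_of_rightInverse hle hW hz hR₀
    (fun f => ⟨hmem f, by rw [heq f]; abel⟩) hfin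

/-- **Finite `finrank` version.**  In the tree deficiency spaces are often recorded by their
dimension (`Module.finrank ℂ (Wmax.eigenspace z) = n` with `n ≠ 0`, e.g. Connes–Moscovici 2022
Lemma 1.1: `= 4` at `z = ±i`); a nonzero `finrank` forces finite-dimensionality.
[cite: ReedSimonIV1978, §XIII.14 Thm. XIII.64 (compact resolvent)] -/
theorem isCompactOperator_resolvent_of_rightInverse_of_finrank (hle : W ≤ Wmax)
    (hW : IsSelfAdjoint W) {z : ℂ} (hz : z.im ≠ 0) {R₀ : H →L[ℂ] H} (hR₀ : IsCompactOperator R₀)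
    (hinv : ∀ f, ∃ h : R₀ f ∈ Wmax.domain, (Wmax ⟨R₀ f, h⟩ : H) - z • R₀ f = f)
    {n : ℕ} (hn : n ≠ 0) (hrank : Module.finrank ℂ (Wmax.eigenspace z) = n) :
    IsCompactOperator (resolvent hW hz) :=
  isCompactOperator_resolvent_of_rightInverse hle hW hz hR₀ hinv
    (Module.finite_of_finrank_pos (by omega))

end Literature.Analysis.UnboundedOperators

end
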